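import Summits.Ventures.PercRepro.ClassSwap

/-!
# PercRepro — ORBIT-2 per interval ⇒ at all weights: mine-2's hierarchy for C-021 (typer-2, gen 6)

`conjectures/C-021.md` states the per-interval inequality `Orbit2` (`2·a₁₃ ≤ c₂`) and records that it implies
the probability form (ii) `2·T·B ≤ P1 + P2 + P3` at all edge weights «by mine-2's hierarchy (per orbit ⇒
multivariate ⇒ all weights)». This file proves that step in Lean:

* **`twoCopy_eq_sum_antipodalPairs`** — the two-copy sum grouped by antipodal pairs: for any `F`,
  `Σ_{ω,ω'} w(ω) w(ω') F(ω, ω') = Σ_{(u, v)} w(v) w(u) · Σ_{x ∈ antipodalPairs u v} F(x.1, x.2)`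
  (log-modularity `weight_inf_mul_weight_sup` + `Finset.sum_fiberwise`);
* **`antipodalPairs_eq_empty_of_not_le`** / **`sup_inf_compl_of_le`** — the nonempty fibres are the intervals
  `[v, u]`, `v ≤ u`, i.e. `I = v`, `D = u ⊓ vᶜ` with `I ⊓ D = ⊥` and `I ⊔ D = u`;
* **`pairCount_TB_le_antipodalCount`** / **`intervalCount_le_pairCountSnd`** — the pair counts of a fibre are
  bounded by the interval counts `a₁₃`, `c₂` (injections `x ↦ x.2 ⊓ D` and `A ↦ (I ⊔ (D ⊓ Aᶜ), I ⊔ A)`);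
* **`antipodalCount_eq_zero_of_markClasses`** — outside the orbits with `N(I) = 3`, `N(I ⊔ D) = 1` the count
  `a₁₃` vanishes, so `Orbit2All` bounds every interval;
* **`C021Prob_of_C021 : C021 → C021Prob`** — the row's hierarchy step, and
  **`c021_const_one_law3' : T · B ≤ P1 + P2 + P3`** at every `p` from `Orbit2ConstOne_holds` (stamp 82) — a
  second, class-level proof of p5's `c021_const_one_law3`.
-/

namespace PercRepro

open Finset Classical

section TwoCopy

variable {E : Type*} [Fintype E] [DecidableEq E]

/-- The fibre of `x ↦ (x.1 ⊔ x.2, x.1 ⊓ x.2)` over `(u, v)` is `antipodalPairs u v`. -/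
theorem filter_joinMeet_eq_antipodalPairs (u v : Config E) :
    (univ.filter fun x : Config E × Config E => (x.1 ⊔ x.2, x.1 ⊓ x.2) = (u, v)) =
      antipodalPairs u v := by
  ext x
  simp only [Finset.mem_filter, Finset.mem_univ, true_and, Prod.mk.injEq, mem_antipodalPairs]
  exact and_comm

/-- **The two-copy sum grouped by antipodal pairs**: `Σ_{ω,ω'} w(ω) w(ω') F(ω, ω') =
Σ_{(u,v)} w(v) w(u) Σ_{x ∈ antipodalPairs u v} F(x.1, x.2)`. -/
theorem twoCopy_eq_sum_antipodalPairs (p : E → ℝ) (F : Config E → Config E → ℝ) :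
    ∑ ω : Config E, ∑ ω' : Config E, weight p ω * weight p ω' * F ω ω' =
      ∑ uv : Config E × Config E, weight p uv.2 * weight p uv.1 *
        ∑ x ∈ antipodalPairs uv.1 uv.2, F x.1 x.2 := by
  rw [← Fintype.sum_prod_type']
  rw [← Finset.sum_fiberwise univ (fun x : Config E × Config E => (x.1 ⊔ x.2, x.1 ⊓ x.2))
    (fun x => weight p x.1 * weight p x.2 * F x.1 x.2)]
  refine Finset.sum_congr rfl fun uv _ => ?_
  rw [filter_joinMeet_eq_antipodalPairs, Finset.mul_sum]
  refine Finset.sum_congr rfl fun x hx => ?_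
  rw [mem_antipodalPairs] at hx
  rw [weight_inf_mul_weight_sup p x.1 x.2, hx.1, hx.2]

/-- `antipodalPairs u v` is empty unless `v ≤ u`. -/
theorem antipodalPairs_eq_empty_of_not_le {u v : Config E} (h : ¬ v ≤ u) :
    antipodalPairs u v = ∅ := by
  ext x
  constructor
  · intro hx
    rw [mem_antipodalPairs] at hx
    have hle : x.1 ⊓ x.2 ≤ x.1 ⊔ x.2 := inf_le_sup
    rw [hx.1, hx.2] at hle
    exact absurd hle h
  · intro hx
    exact absurd hx (Finset.notMem_empty x)

omit [Fintype E] [DecidableEq E] in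
/-- For `v ≤ u`: `v ⊔ (u ⊓ vᶜ) = u`. -/
theorem sup_inf_compl_of_le {u v : Config E} (h : v ≤ u) : v ⊔ (u ⊓ vᶜ) = u := by
  rw [sup_inf_left, sup_compl_eq_top, inf_top_eq, sup_eq_right.mpr h]

omit [Fintype E] [DecidableEq E] in
/-- `v ⊓ (u ⊓ vᶜ) = ⊥`. -/
theorem inf_inf_compl (u v : Config E) : v ⊓ (u ⊓ vᶜ) = ⊥ := by
  rw [inf_left_comm, inf_compl_self, inf_bot_eq]

end TwoCopy

namespace MultiGraph

variable {V E : Type*} (G : MultiGraph V E) [Fintype E] [DecidableEq E]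

/-- The antipode of an antipodal pair of `[I, I ⊔ D]` (`I ⊓ D = ⊥`) is `I ⊔ (D ⊓ Aᶜ)` for `A = ω' ⊓ D`. -/
theorem fst_eq_sup_inf_compl_of_mem_antipodalPairs {I D : Config E} (hID : I ⊓ D = ⊥)
    {x : Config E × Config E} (hx : x ∈ antipodalPairs (I ⊔ D) I) :
    x.1 = I ⊔ (D ⊓ (x.2 ⊓ D)ᶜ) := by
  rw [mem_antipodalPairs] at hx
  funext e
  have hxe := congrFun hx.1 e
  have hxe' := congrFun hx.2 e
  have hIDe := congrFun hID e
  simp only [Pi.inf_apply, Pi.sup_apply, Pi.bot_apply, Pi.compl_apply] at hxe hxe' hIDe ⊢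
  revert hxe hxe' hIDe
  cases x.1 e <;> cases x.2 e <;> cases I e <;> cases D e <;> decide

variable [DecidableEq V] [Fintype V]

/-- `#{(ω, ω') ∈ P : ω' ∈ T ∧ ω ∈ B} ≤ a₁₃` — through `A = ω' ⊓ D` (`T = allConn3`, `B = allSep3` as sets). -/
theorem pairCount_TB_le_antipodalCount (a b c : V) {I D : Config E} (hID : I ⊓ D = ⊥)
    (B T : Set (Config E)) (hB : ∀ ω, ω ∈ B → ω ∈ G.allSep3 a b c)
    (hT : ∀ ω, ω ∈ T → ω ∈ G.allConn3 a b c) :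
    pairCountIn (I ⊔ D) I B T ≤ G.antipodalCount ![a, b, c] I D 1 3 := by
  unfold pairCountIn antipodalCount
  refine Finset.card_le_card_of_injOn (fun x => x.2 ⊓ D) ?_ ?_
  · intro x hx
    rw [Finset.mem_coe, Finset.mem_filter] at hx
    obtain ⟨hP, hxB, hxT⟩ := hx
    rw [Finset.mem_coe, Finset.mem_filter]
    refine ⟨Finset.mem_univ _, inf_le_right, ?_, ?_⟩
    · rw [G.markClasses_eq_one_iff, ← snd_eq_sup_inf_of_mem_antipodalPairs hP]
      exact hT _ hxT
    · rw [G.markClasses_eq_three_iff, ← fst_eq_sup_inf_compl_of_mem_antipodalPairs hID hP]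
      exact hB _ hxB
  · intro x hx y hy hxy
    rw [Finset.mem_coe, Finset.mem_filter] at hx hy
    have h2 : x.2 = y.2 := by
      rw [snd_eq_sup_inf_of_mem_antipodalPairs hx.1, snd_eq_sup_inf_of_mem_antipodalPairs hy.1]
      exact congrArg (I ⊔ ·) hxy
    exact Prod.ext (fst_eq_of_mem_antipodalPairs hID hx.1 hy.1 h2) h2

/-- `c₂ ≤ #{(ω, ω') ∈ P : ω' ∈ Y}` — through `A ↦ (I ⊔ (D ⊓ Aᶜ), I ⊔ A)` (`Y = onePair3` as a set). -/
theorem intervalCount_le_pairCountSnd (a b c : V) {I D : Config E} (hID : I ⊓ D = ⊥)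
    (Y : Set (Config E)) (hY : ∀ ω, ω ∈ G.onePair3 a b c → ω ∈ Y) :
    G.intervalCount ![a, b, c] I D 2 ≤ pairCountSnd (I ⊔ D) I Y := by
  unfold intervalCount pairCountSnd
  refine Finset.card_le_card_of_injOn (fun A => (I ⊔ (D ⊓ Aᶜ), I ⊔ A)) ?_ ?_
  · intro A hA
    rw [Finset.mem_coe, Finset.mem_filter] at hA
    obtain ⟨_, hAD, h2⟩ := hA
    rw [Finset.mem_coe, Finset.mem_filter]
    refine ⟨pair_mem_antipodalPairs hAD, hY _ ?_⟩
    rw [← G.markClasses_eq_two_iff]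
    exact h2
  · intro A hA B hB hAB
    simp only [Prod.mk.injEq] at hAB
    rw [Finset.mem_coe, Finset.mem_filter] at hA hB
    calc A = (I ⊔ A) ⊓ D := by
          rw [inf_sup_right, hID, bot_sup_eq, inf_eq_left.mpr hA.2.1]
      _ = (I ⊔ B) ⊓ D := by rw [hAB.2]
      _ = B := by rw [inf_sup_right, hID, bot_sup_eq, inf_eq_left.mpr hB.2.1]

/-- Outside the orbits with `N(I) = 3` and `N(I ⊔ D) = 1` the count `a₁₃` vanishes. -/
theorem antipodalCount_eq_zero_of_markClasses (a b c : V) (I D : Config E)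
    (h : ¬ (G.markClasses I ![a, b, c] = 3 ∧ G.markClasses (I ⊔ D) ![a, b, c] = 1)) :
    G.antipodalCount ![a, b, c] I D 1 3 = 0 := by
  unfold antipodalCount
  rw [Finset.card_eq_zero, Finset.filter_eq_empty_iff]
  intro A _ hA
  obtain ⟨hAD, h1, h3⟩ := hA
  apply h
  constructor
  · rw [G.markClasses_eq_three_iff, allSep3, Finset.mem_filter] at h3 ⊢
    refine ⟨Finset.mem_univ _, ?_, ?_, ?_⟩
    · exact fun hc => h3.2.1 (hc.mono le_sup_left)
    · exact fun hc => h3.2.2.1 (hc.mono le_sup_left)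
    · exact fun hc => h3.2.2.2 (hc.mono le_sup_left)
  · rw [G.markClasses_eq_one_iff, allConn3, Finset.mem_filter] at h1 ⊢
    have hle : I ⊔ A ≤ I ⊔ D := sup_le_sup_left hAD I
    exact ⟨Finset.mem_univ _, h1.2.1.mono hle, h1.2.2.1.mono hle, h1.2.2.2.mono hle⟩

/-- **ORBIT-2 on every interval**: `Orbit2All` gives `2·a₁₃ ≤ c₂` on EVERY interval with `I ⊓ D = ⊥`. -/
theorem orbit2_of_orbit2All {a b c : V} (h : G.Orbit2All a b c) {I D : Config E} (hID : I ⊓ D = ⊥) :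
    2 * G.antipodalCount ![a, b, c] I D 1 3 ≤ G.intervalCount ![a, b, c] I D 2 := by
  by_cases hN : G.markClasses I ![a, b, c] = 3 ∧ G.markClasses (I ⊔ D) ![a, b, c] = 1
  · exact h I D hID hN.1 hN.2
  · rw [G.antipodalCount_eq_zero_of_markClasses a b c I D hN]
    exact Nat.zero_le _

/-- `T = allConn3` as an event of the rows: `law3 0`. -/
theorem law3_zero_eq_prob_allConn3 (p : E → ℝ) (a b c : V) :
    G.law3 p a b c 0 = prob p {ω | ω ∈ G.allConn3 a b c} := by
  rw [MultiGraph.law3_zero, G.partitionEvent_row_abc]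
  congr 1
  ext ω
  obtain ⟨h1, _, _⟩ := G.conn_three_trans a b c (ω := ω)
  simp only [Set.mem_inter_iff, mem_connEvent, Set.mem_setOf_eq, allConn3, Finset.mem_filter,
    Finset.mem_univ, true_and]
  exact ⟨fun h => ⟨h.1, h.2, h1 h.1 h.2⟩, fun h => ⟨h.1, h.2.1⟩⟩

/-- `B = allSep3` as an event of the rows: `law3 4`. -/
theorem law3_four_eq_prob_allSep3 (p : E → ℝ) (a b c : V) :
    G.law3 p a b c 4 = prob p {ω | ω ∈ G.allSep3 a b c} := by
  rw [MultiGraph.law3_four, G.partitionEvent_row_a_b_c]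
  congr 1
  ext ω
  simp only [Set.mem_inter_iff, mem_sepEvent, Set.mem_setOf_eq, allSep3, Finset.mem_filter,
    Finset.mem_univ, true_and]
  tauto

/-- `Y = onePair3` as an event of the rows: `law3 1 + law3 2 + law3 3`. -/
theorem law3_one_add_two_add_three_eq_prob_onePair3 (p : E → ℝ) (a b c : V) :
    G.law3 p a b c 1 + G.law3 p a b c 2 + G.law3 p a b c 3 =
      prob p {ω | ω ∈ G.onePair3 a b c} := by
  rw [MultiGraph.law3_one, MultiGraph.law3_two, MultiGraph.law3_three, G.partitionEvent_row_ab_c,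
    G.partitionEvent_row_ac_b, G.partitionEvent_row_bc_a]
  set X₁ := G.connEvent a b ∩ G.sepEvent a c
  set X₂ := G.connEvent a c ∩ G.sepEvent a b
  set X₃ := G.connEvent b c ∩ G.sepEvent a b
  have h12 : X₁ ∩ X₂ = ∅ := by
    ext ω
    simp only [X₁, X₂, Set.mem_inter_iff, mem_connEvent, mem_sepEvent, Set.mem_empty_iff_false,
      iff_false]
    tauto
  have h123 : (X₁ ∪ X₂) ∩ X₃ = ∅ := by
    ext ω
    obtain ⟨h1, h2, h3⟩ := G.conn_three_trans a b c (ω := ω)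
    simp only [X₁, X₂, X₃, Set.mem_inter_iff, Set.mem_union, mem_connEvent, mem_sepEvent,
      Set.mem_empty_iff_false, iff_false]
    tauto
  have hY : X₁ ∪ X₂ ∪ X₃ = {ω | ω ∈ G.onePair3 a b c} := by
    ext ω
    obtain ⟨h1, h2, h3⟩ := G.conn_three_trans a b c (ω := ω)
    simp only [X₁, X₂, X₃, Set.mem_union, Set.mem_inter_iff, mem_connEvent, mem_sepEvent,
      Set.mem_setOf_eq, onePair3, Finset.mem_filter, Finset.mem_univ, true_and]
    tauto
  have e1 := prob_union_add_inter p X₁ X₂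
  have e2 := prob_union_add_inter p (X₁ ∪ X₂) X₃
  rw [h12, prob_empty] at e1
  rw [h123, prob_empty, hY] at e2
  linarith

/-- **`T · B` grouped by antipodal pairs**: `Σ_{(u,v)} w(v) w(u) · #{(ω, ω') ∈ P(u,v) : ω ∈ B, ω' ∈ T}`. -/
theorem law3_zero_mul_four_eq_sum (p : E → ℝ) (a b c : V) :
    G.law3 p a b c 0 * G.law3 p a b c 4 =
      ∑ uv : Config E × Config E, weight p uv.2 * weight p uv.1 *
        (pairCountIn uv.1 uv.2 {ω | ω ∈ G.allSep3 a b c} {ω | ω ∈ G.allConn3 a b c} : ℝ) := by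
  set T : Set (Config E) := {ω | ω ∈ G.allConn3 a b c}
  set B : Set (Config E) := {ω | ω ∈ G.allSep3 a b c}
  have key := twoCopy_eq_sum_antipodalPairs p
    (fun ω ω' => B.indicator (1 : Config E → ℝ) ω * T.indicator 1 ω')
  simp only [sum_antipodalPairs_indicator_mul] at key
  rw [← key, G.law3_zero_eq_prob_allConn3, G.law3_four_eq_prob_allSep3, mul_comm,
    prob_mul_prob_eq_sum]

/-- **`P1 + P2 + P3` grouped by antipodal pairs**: `Σ_{(u,v)} w(v) w(u) · #{(ω, ω') ∈ P(u,v) : ω' ∈ Y}`. -/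
theorem law3_one_add_two_add_three_eq_sum (p : E → ℝ) (a b c : V) :
    G.law3 p a b c 1 + G.law3 p a b c 2 + G.law3 p a b c 3 =
      ∑ uv : Config E × Config E, weight p uv.2 * weight p uv.1 *
        (pairCountSnd uv.1 uv.2 {ω | ω ∈ G.onePair3 a b c} : ℝ) := by
  set Y : Set (Config E) := {ω | ω ∈ G.onePair3 a b c}
  have key := twoCopy_eq_sum_antipodalPairs p (fun _ ω' => Y.indicator (1 : Config E → ℝ) ω')
  simp only [sum_antipodalPairs_indicator_snd] at key
  rw [← key, G.law3_one_add_two_add_three_eq_prob_onePair3]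
  unfold prob
  rw [Finset.sum_comm]
  refine Finset.sum_congr rfl fun ω' _ => ?_
  rw [← Finset.sum_mul, ← Finset.sum_mul, sum_weight, one_mul, Set.indicator_apply,
    Set.indicator_apply]
  split_ifs <;> simp

/-- On every fibre `(u, v)`: `#{(ω,ω') antipodal : ω ∈ B, ω' ∈ T} ≤ a₁₃ ≤ … ≤ #{ω' ∈ Y}`-type bounds from the
interval statement — the generic transfer: if `k · a₁₃ ≤ c₂` on every interval with `I ⊓ D = ⊥`, then
`k · #TB ≤ #Y` on every fibre. -/
theorem pairCount_le_of_intervals (a b c : V) (k : ℕ)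
    (h : ∀ I D : Config E, I ⊓ D = ⊥ →
      k * G.antipodalCount ![a, b, c] I D 1 3 ≤ G.intervalCount ![a, b, c] I D 2)
    (uv : Config E × Config E) :
    k * pairCountIn uv.1 uv.2 {ω | ω ∈ G.allSep3 a b c} {ω | ω ∈ G.allConn3 a b c} ≤
      pairCountSnd uv.1 uv.2 {ω | ω ∈ G.onePair3 a b c} := by
  by_cases hvu : uv.2 ≤ uv.1
  · have hID := inf_inf_compl uv.1 uv.2
    have hu := sup_inf_compl_of_le hvu
    have h1 := G.pairCount_TB_le_antipodalCount a b c hID _ _ (fun _ hω => hω) (fun _ hω => hω)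
    have h2 := G.intervalCount_le_pairCountSnd a b c hID _ (fun _ hω => hω)
    have h3 := h _ _ hID
    rw [hu] at h1 h2
    calc k * pairCountIn uv.1 uv.2 {ω | ω ∈ G.allSep3 a b c} {ω | ω ∈ G.allConn3 a b c}
        ≤ k * G.antipodalCount ![a, b, c] uv.2 (uv.1 ⊓ uv.2ᶜ) 1 3 := Nat.mul_le_mul_left k h1
      _ ≤ G.intervalCount ![a, b, c] uv.2 (uv.1 ⊓ uv.2ᶜ) 2 := h3
      _ ≤ _ := h2
  · have hP := antipodalPairs_eq_empty_of_not_le hvu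
    unfold pairCountIn pairCountSnd
    rw [hP]
    simp

/-- **Per interval ⇒ all weights** (the generic hierarchy step for the `(1,3)`-vs-`2` counts): if
`k · a₁₃ ≤ c₂` on every interval with `I ⊓ D = ⊥`, then `k · T · B ≤ P1 + P2 + P3` at every `p ∈ [0,1]^E`. -/
theorem law3_of_intervals (a b c : V) (k : ℕ)
    (h : ∀ I D : Config E, I ⊓ D = ⊥ →
      k * G.antipodalCount ![a, b, c] I D 1 3 ≤ G.intervalCount ![a, b, c] I D 2)
    {p : E → ℝ} (hp : IsProb p) :
    (k : ℝ) * (G.law3 p a b c 0 * G.law3 p a b c 4) ≤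
      G.law3 p a b c 1 + G.law3 p a b c 2 + G.law3 p a b c 3 := by
  rw [G.law3_zero_mul_four_eq_sum, G.law3_one_add_two_add_three_eq_sum, Finset.mul_sum]
  refine Finset.sum_le_sum fun uv _ => ?_
  have hk := G.pairCount_le_of_intervals a b c k h uv
  have hk' : ((k * pairCountIn uv.1 uv.2 {ω | ω ∈ G.allSep3 a b c} {ω | ω ∈ G.allConn3 a b c} : ℕ) : ℝ) ≤
      (pairCountSnd uv.1 uv.2 {ω | ω ∈ G.onePair3 a b c} : ℝ) := by exact_mod_cast hk
  push_cast at hk'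
  have hw : 0 ≤ weight p uv.2 * weight p uv.1 := mul_nonneg (weight_nonneg hp _) (weight_nonneg hp _)
  calc (k : ℝ) * (weight p uv.2 * weight p uv.1 *
        (pairCountIn uv.1 uv.2 {ω | ω ∈ G.allSep3 a b c} {ω | ω ∈ G.allConn3 a b c} : ℝ))
      = weight p uv.2 * weight p uv.1 *
          ((k : ℝ) * (pairCountIn uv.1 uv.2 {ω | ω ∈ G.allSep3 a b c} {ω | ω ∈ G.allConn3 a b c} : ℝ)) := by
        ring
    _ ≤ weight p uv.2 * weight p uv.1 *
          (pairCountSnd uv.1 uv.2 {ω | ω ∈ G.onePair3 a b c} : ℝ) :=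
        mul_le_mul_of_nonneg_left hk' hw

end MultiGraph

/-- **C-021 per interval implies C-021 at all weights on finite vertex sets** (mine-2's hierarchy «per orbit ⇒
all weights»): `C021` gives the inequality of `C021Prob` for every finite multigraph (`C021Prob` as typed also
allows an infinite vertex set with finitely many edges, where the marks' connectivity only sees the finite
subgraph of the endpoints; `C021` itself is stated on finite vertex sets). -/
theorem C021Prob_of_C021 (h : C021) {V E : Type} [DecidableEq V] [Fintype V] [Fintype E]
    [DecidableEq E] (G : MultiGraph V E) {p : E → ℝ} (hp : IsProb p) (a b c : V) :
    2 * (G.law3 p a b c 0 * G.law3 p a b c 4) ≤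
      G.law3 p a b c 1 + G.law3 p a b c 2 + G.law3 p a b c 3 := by
  have := G.law3_of_intervals a b c 2 (fun I D hID => G.orbit2_of_orbit2All (h G a b c) hID) hp
  exact_mod_cast this

/-- **The constant-1 form of C-021 at all weights from the class level** (`Orbit2ConstOne_holds`, stamp 82):
`T · B ≤ P1 + P2 + P3` — a second, class-level proof of p5's `c021_const_one_law3`. -/
theorem c021_const_one_law3' {V E : Type} [DecidableEq V] [Fintype V] [Fintype E] [DecidableEq E]
    (G : MultiGraph V E) {p : E → ℝ} (hp : IsProb p) (a b c : V) :
    G.law3 p a b c 0 * G.law3 p a b c 4 ≤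
      G.law3 p a b c 1 + G.law3 p a b c 2 + G.law3 p a b c 3 := by
  have := G.law3_of_intervals a b c 1
    (fun I D hID => by simpa using G.orbit2_const_one a b c hID) hp
  simpa using this

end PercRepro
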